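import Literature.NumberTheory.LFunctions.MatomakiRadziwillTaoT2OfVK
import HarnessLib

/-!
# Matomäki–Radziwiłł–Tao 2015, Proposition A.3 on `𝒯₂` for MULTIPLICATIVE `f`

Topic `Literature/NumberTheory/LFunctions`.  Everything in this file is PROVED; no definitions, no named facts.

Proposition A.3 of K. Matomäki, M. Radziwiłł, T. Tao, *An averaged form of Chowla's conjecture*, Algebra & Number
Theory 9 (2015), Appendix A, is stated for `1`-bounded MULTIPLICATIVE `f` (the named fact
`MatomakiRadziwillTao2015_propA3` quantifies over `f.IsMultiplicative`), while the tree's treatment of the range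
`𝒯₂ = {|t - t₁| ≥ (log X)^{1/16}}` (`MRT2015.T2half_of_vk`, `MRT2015.exists_cofactor_bound_of_vk`) is written for
completely multiplicative `f`.  Complete multiplicativity is not needed there: Matomäki–Radziwiłł's Proposition 1 for
general coefficients (`Sieve.prop1_coef_of_lemma11`) asks for the factorisations `a(mp) = b_j(m) c(p)` and
`a(mp) = a(m) c(p)` only for `p ∤ m`, where multiplicativity of `f` suffices, and the Halász input of Lemma A.4
(`Sieve.MatomakiRadziwillL3C.lemma3_complex_of_floor`) is stated for multiplicative `f`.  This file records the two
statements for multiplicative `f`, with the proofs of the tree verbatim: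

* `MRT2015.exists_cofactor_bound_mult_of_vk` — the bound `hR` on the cofactor polynomials of the `𝒰`-part for
  `a = f 1_𝒮`, `f` multiplicative (proof of `exists_cofactor_bound_of_vk`; the sifted copies `f g_𝒥` are multiplicative
  by `IsMultiplicative.pmul`);
* `MRT2015.T2one_mult_of_vk` — the bound on `∫_{T₀}^{T} |F(1+it)|²` over pieces `[T₀, T] ⊆ [0, X/2]` of the range
  `𝒯₂` with `T ≥ 1` (the `T ≥ 1` branch of the proof of `T2half_of_vk`; pieces with `T < 1` are not needed for
  Proposition A.3, whose two sides are monotone in `T`).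

## References
* K. Matomäki, M. Radziwiłł, T. Tao, Algebra & Number Theory 9 (2015), 2167–2196 (arXiv:1503.05121 §6): proof of
  Proposition A.3 (= Prop. 6.3), Lemma A.4. [cite: MatomakiRadziwillTao2015, Appendix A, Proposition A.3 (proof)]
* K. Matomäki, M. Radziwiłł, Ann. of Math. (2) 183 (2016), Proposition 1, Lemmas 3, 5, 12, §8.
  [cite: MatomakiRadziwillAnnals2016, Proposition 1]

## Design choices
* Nothing of the tree is restated or changed; the two theorems are copies of the tree's proofs with the hypothesis
  `(∀ m n, f (m n) = f m f n) ∧ f 1 = 1` replaced by `f.IsMultiplicative` at the (two) places where it is used.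
-/

noncomputable section

open Finset Real Complex Filter MeasureTheory
open scoped ComplexConjugate Classical

namespace Literature.NumberTheory.LFunctions

namespace MRT2015

open Sieve (SieveIntervalSystem minPretentiousDistSq minPretentiousDistSq_nonneg pretentiousDistSq blockCofactorPoly
  primeDivisorsIn)
open Sieve.MatomakiRadziwillL4A (toComplexAF toComplexAF_apply twistAF Msum)
open Sieve.MatomakiRadziwillL3 (sieveInd sieveInd_prime primesPQ primesPQ_prime Ystar)
open Sieve.MatomakiRadziwillL3C (siftedTwistC)

variable {η X₀ : ℝ}

/-- `f g_𝒥` is multiplicative and `1`-bounded for multiplicative `1`-bounded `f` (cf. `pmul_g_props`). [folklore] -/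
theorem pmul_g_props_mult (I : SieveIntervalSystem η X₀) {f : ArithmeticFunction ℂ} (hf : f.IsMultiplicative)
    (hfb : ∀ n, ‖f n‖ ≤ 1) (𝒥 : Finset ℕ) :
    (f.pmul (toComplexAF (I.g 𝒥))).IsMultiplicative ∧ ∀ n, ‖(f.pmul (toComplexAF (I.g 𝒥))) n‖ ≤ 1 := by
  refine ⟨hf.pmul (Sieve.MatomakiRadziwillL4A.isMultiplicative_toComplexAF (I.isMultiplicative_g 𝒥)), fun n => ?_⟩
  rw [ArithmeticFunction.pmul_apply, norm_mul]
  exact mul_le_one₀ (hfb n) (norm_nonneg _) (Sieve.MatomakiRadziwillL4A.norm_toComplexAF_le (I.abs_g_le_one 𝒥) n)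

set_option maxHeartbeats 1600000 in
/-- **Lemma A.4 for the sifted copies of a MULTIPLICATIVE `f`, in the shape `hR` of the `𝒰`-part** (from any
Vinogradov–Korobov region `HasVKZeroFreeRegion cVK TVK`, `cVK > 0`): the statement of `exists_cofactor_bound_of_vk` with
"completely multiplicative, `f 1 = 1`" replaced by `f.IsMultiplicative` — there is an absolute `C₃ ≥ 0` such that for all
large `X`, every interval system `I`, every multiplicative `f : ArithmeticFunction ℂ` with `|f| ≤ 1`, every minimiser `t₁`
of `u ↦ 𝔻(f, n^{iu}; X)²` on `|u| ≤ X`, every `t ∈ [0, X/2]` with `|t − t₁| ≥ (log X)^{1/16}` and every block `v` of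
the `𝒰`-part, `|R_{v,H}(1+it)| ≤ 2^J · 3 C₃ (log X)^{1/50 − 1/16}` for the cofactor polynomial of `a = f 1_𝒮`.
Proof: that of `exists_cofactor_bound_of_vk` verbatim (Lemma 5, the sifted copies `f g_𝒥` — multiplicative by
`pmul_g_props_mult` — and `MatomakiRadziwillL3C.lemma3_complex_of_floor`, which is stated for multiplicative `f`).
[cite: MatomakiRadziwillTao2015, Appendix A, Lemma A.4] [cite: MatomakiRadziwillAnnals2016, Lemma 3] -/
theorem exists_cofactor_bound_mult_of_vk {cVK TVK : ℝ} (hcVK : 0 < cVK) (hVK : HasVKZeroFreeRegion cVK TVK) :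
    ∃ C₃ : ℝ, 0 ≤ C₃ ∧ ∀ᶠ X : ℝ in atTop, ∀ (η X₀ : ℝ) (I : SieveIntervalSystem η X₀) (f : ArithmeticFunction ℂ),
      f.IsMultiplicative → (∀ n, ‖f n‖ ≤ 1) →
      ∀ t₁ : ℝ, |t₁| ≤ X →
      (∀ u : ℝ, |u| ≤ X → pretentiousDistSq f (fun n : ℕ => (n : ℂ) ^ ((t₁ : ℂ) * Complex.I)) X ≤
        pretentiousDistSq f (fun n : ℕ => (n : ℂ) ^ ((u : ℂ) * Complex.I)) X) →
      ∀ t : ℝ, 0 ≤ t → t ≤ X / 2 → Real.log X ^ (1 / 16 : ℝ) ≤ |t - t₁| →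
      ∀ v ∈ Icc ⌊Real.log X ^ (1 / 50 : ℝ) * Real.log (Real.exp (Real.log X ^ (97 / 100 : ℝ)))⌋₊
          ⌊Real.log X ^ (1 / 50 : ℝ) * Real.log (Real.exp (Real.log X ^ (99 / 100 : ℝ)))⌋₊,
        ‖blockCofactorPoly (fun n : ℕ => if I.Mem n then f n else 0) X (Real.exp (Real.log X ^ (97 / 100 : ℝ)))
            (Real.exp (Real.log X ^ (99 / 100 : ℝ))) (Real.log X ^ (1 / 50 : ℝ)) v t‖ ≤
          2 ^ I.J * (3 * C₃ * Real.log X ^ (1 / 50 - 1 / 16 : ℝ)) := by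
  classical
  obtain ⟨C, hC0, hL3⟩ := Sieve.MatomakiRadziwillL3C.lemma3_complex_of_floor
  set c : ℝ := (Real.sqrt 2 - 1) / 2 with hc
  set K_M : ℝ := Real.exp ((39 / 40) * (16 + 10 * c)) with hKM
  have hKM0 : 0 ≤ K_M := (Real.exp_pos _).le
  refine ⟨C * (1 + K_M), by positivity, ?_⟩
  -- eventualities in `X`
  have h2 : Tendsto (fun x : ℝ => 2 * x) atTop atTop := tendsto_id.const_mul_atTop (by norm_num)
  have hθ : (2 : ℝ) / 3 < 27 / 40 := by norm_num
  have hsize := Real.tendsto_log_atTop.eventually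
    (Sieve.MatomakiRadziwillProp1.eventually_size (by norm_num : (0 : ℝ) < 1 / 12))
  have hpow := ((tendsto_rpow_atTop (by norm_num : (0 : ℝ) < 1 - 27 / 40)).comp Real.tendsto_log_atTop).eventually_ge_atTop
    (64 : ℝ)
  filter_upwards [h2.eventually (TwistedPrimeSumTail.pretentiousDistSq_one_twist_tail_ge_of_vk hcVK hVK hθ), hsize, hpow,
    Real.tendsto_log_atTop.eventually_ge_atTop (2 * (4 : ℝ) ^ 16), eventually_ge_atTop (16 : ℝ)]
    with X hKh hsz hpw hL816 hX16
  obtain ⟨-, c2, c3, -, c5, -, -⟩ := hsz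
  intro η X₀ I f hf hfb t₁ ht₁ hmin t ht0 htX hfar v hv
  set L := Real.log X with hLdef
  set H := L ^ (1 / 50 : ℝ) with hHdef
  have h416 : (4 : ℝ) ^ 16 = 4294967296 := by norm_num
  have hX0 : 0 < X := by linarith
  have hL1 : 1 ≤ L := by rw [h416] at hL816; linarith
  have hL0 : 0 < L := by linarith
  obtain ⟨hL400, h40, hL99, hL97, h97, h9799⟩ := Sieve.MatomakiRadziwillU.Lfacts hL1 c2 c3
  rw [Real.log_exp, Real.log_exp] at hv
  have hH2 : 2 ≤ H := c2
  have hH0 : 0 < H := by linarith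
  obtain ⟨hx1, hx2⟩ := Sieve.MatomakiRadziwillU.div_mem_of_mem_Icc hH0 (Real.rpow_nonneg hL0.le _) hv
  set x : ℝ := (v : ℝ) / H with hxdef
  have hx0 : 0 ≤ x := by positivity
  set X' : ℝ := X * Real.exp (-x) with hX'def
  have hX'0 : 0 < X' := by positivity
  have hlogX' : Real.log X' = L - x := by
    rw [hX'def, Real.log_mul hX0.ne' (Real.exp_pos _).ne', Real.log_exp]; ring
  have hy1 : L / 2 ≤ Real.log X' := by
    rw [hlogX']
    have : L ^ (99 / 100 : ℝ) ≤ L / 40 := by linarith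
    linarith
  have hy2 : Real.log X' ≤ L := by rw [hlogX']; linarith
  have hX'X : X' ≤ X := by
    rw [hX'def]
    have : Real.exp (-x) ≤ 1 := by rw [Real.exp_le_one_iff]; linarith
    nlinarith
  have hX'exp : X' = Real.exp (Real.log X') := (Real.exp_log hX'0).symm
  -- hypotheses of the complex Lemma 3 at the scale `X'`
  have hP2 : 2 ≤ Real.exp (L ^ (97 / 100 : ℝ)) := by
    have := Real.add_one_le_exp (L ^ (97 / 100 : ℝ)); linarith
  have hPQ : Real.exp (L ^ (97 / 100 : ℝ)) ≤ Real.exp (L ^ (99 / 100 : ℝ)) := Real.exp_le_exp.2 h9799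
  have hQX' : Real.exp (L ^ (99 / 100 : ℝ)) ≤ X' := by
    rw [hX'exp]
    refine Real.exp_le_exp.2 ?_
    have : L ^ (99 / 100 : ℝ) ≤ L / 40 := by linarith
    linarith
  have hX'big : Real.exp ((4 : ℝ) ^ 16) ≤ X' := by
    rw [hX'exp]; exact Real.exp_le_exp.2 (by linarith)
  -- the window `T_H = L^{1/16}/4`
  set TH : ℝ := L ^ (1 / 16 : ℝ) / 4 with hTHdef
  have hL16 : (4 : ℝ) ≤ L ^ (1 / 16 : ℝ) := by
    have : (4 : ℝ) = ((4 : ℝ) ^ 16) ^ (1 / 16 : ℝ) := by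
      rw [← Real.rpow_natCast, ← Real.rpow_mul (by norm_num)]; norm_num
    rw [this]
    exact Real.rpow_le_rpow (by positivity) (by linarith) (by norm_num)
  have hTH1 : 1 ≤ TH := by rw [hTHdef]; linarith
  have hTH4 : Real.log X' ^ (1 / 16 : ℝ) ≤ 4 * TH := by
    rw [hTHdef]
    have : Real.log X' ^ (1 / 16 : ℝ) ≤ L ^ (1 / 16 : ℝ) := Real.rpow_le_rpow (by linarith) hy2 (by norm_num)
    linarith
  -- the floor `M₀` and `K_M`
  set M₀ : ℝ := c * ((13 / 40) * Real.log L - 10) - 16 with hM₀def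
  have hKMineq : Real.exp (-(39 / 40) * M₀) ≤ K_M / Real.log X' ^ (1 / 16 : ℝ) := by
    have h1 := exp_neg_floor_le hL1
    rw [← hc, ← hKM] at h1
    refine h1.trans ?_
    have hpos : 0 < Real.log X' ^ (1 / 16 : ℝ) := Real.rpow_pos_of_pos (by linarith) _
    exact div_le_div_of_nonneg_left hKM0 hpos (Real.rpow_le_rpow (by linarith) hy2 (by norm_num))
  -- the floor holds on the fibres of `X'`
  have hYstar : Ystar X' = X' ^ (1 / 4 : ℝ) / 2 := rfl
  have hYexp : Ystar X' = Real.exp (Real.log X' / 4) / 2 := by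
    rw [hYstar, Real.rpow_def_of_pos hX'0]; ring_nf
  have hlog2 : Real.log 2 < 1 := by have := Real.log_two_lt_d9; linarith
  have hlogY : L / 8 - 1 ≤ Real.log (Ystar X') := by
    rw [hYexp, Real.log_div (Real.exp_pos _).ne' two_ne_zero, Real.log_exp]; linarith
  have hYlow4 : 4 ≤ Ystar X' := by
    rw [hYexp]
    have : (8 : ℝ) ≤ Real.exp (Real.log X' / 4) := by
      have := Real.add_one_le_exp (Real.log X' / 4); rw [h416] at hL816; linarith
    linarith
  have hYlowX' : Ystar X' ≤ X' := by
    rw [hYstar]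
    have h14 : X' ^ (1 / 4 : ℝ) ≤ X' := by
      have hX'1 : 1 ≤ X' := by
        have := Real.add_one_le_exp (Real.log X'); rw [← hX'exp] at this; linarith
      calc X' ^ (1 / 4 : ℝ) ≤ X' ^ (1 : ℝ) := Real.rpow_le_rpow_of_exponent_le hX'1 (by norm_num)
        _ = X' := Real.rpow_one X'
    have : 0 ≤ X' ^ (1 / 4 : ℝ) := by positivity
    linarith
  have hYlowX : Ystar X' ≤ X := hYlowX'.trans hX'X
  -- `exp((log 2X)^θ) ≤ Y_*`: `(log 2X)^θ ≤ (2L)^θ ≤ 2L/L^{1-θ}·… ≤ L/16 ≤ L/8 - 1 - log 2`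
  have hlog2X : Real.log (2 * X) ≤ 2 * L := by
    rw [Real.log_mul two_ne_zero hX0.ne']; rw [h416] at hL816; linarith
  have hlog2X1 : 1 ≤ Real.log (2 * X) := by
    rw [Real.log_mul two_ne_zero hX0.ne']; have : 0 < Real.log 2 := Real.log_pos one_lt_two; linarith
  have hpw' : (64 : ℝ) ≤ L ^ (1 - 27 / 40 : ℝ) := hpw
  have hθpow : Real.log (2 * X) ^ (27 / 40 : ℝ) ≤ L / 16 := by
    have h1 : Real.log (2 * X) ^ (27 / 40 : ℝ) ≤ (2 * L) ^ (27 / 40 : ℝ) :=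
      Real.rpow_le_rpow (by linarith) hlog2X (by norm_num)
    have h2 : (2 * L) ^ (27 / 40 : ℝ) * (2 * L) ^ (1 - 27 / 40 : ℝ) = 2 * L := by
      rw [← Real.rpow_add (by linarith)]; norm_num
    have h3 : (64 : ℝ) ≤ (2 * L) ^ (1 - 27 / 40 : ℝ) :=
      hpw'.trans (Real.rpow_le_rpow hL0.le (by linarith) (by norm_num))
    have h4 : 0 ≤ (2 * L) ^ (27 / 40 : ℝ) := by positivity
    nlinarith
  have hYlowexp : Real.exp (Real.log (2 * X) ^ (27 / 40 : ℝ)) ≤ Ystar X' := by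
    have : Real.exp (Real.log (2 * X) ^ (27 / 40 : ℝ)) ≤ Real.exp (Real.log (Ystar X')) :=
      Real.exp_le_exp.2 (by rw [h416] at hL816; linarith)
    rwa [Real.exp_log (by linarith)] at this
  have hlog16 : Real.log X ≤ 16 * Real.log (Ystar X') := by rw [← hLdef]; rw [h416] at hL816; linarith
  -- `B₀ = (13/40) log L - 10 ≤ log log Y - θ log log 2X - 6` on `[Y_*, X]`
  have hB₀ : ∀ Y : ℝ, Ystar X' ≤ Y → Y ≤ X →
      (13 / 40) * Real.log L - 10 ≤ Real.log (Real.log Y) - 27 / 40 * Real.log (Real.log (2 * X)) - 6 := by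
    intro Y hY _
    have h1 : Real.log L - Real.log 16 ≤ Real.log (Real.log Y) := by
      have hlogY' : L / 16 ≤ Real.log Y := by
        have := Real.log_le_log (by linarith) hY; rw [h416] at hL816; linarith
      have := Real.log_le_log (by positivity) hlogY'
      rwa [Real.log_div hL0.ne' (by norm_num)] at this
    have h2 : Real.log (Real.log (2 * X)) ≤ Real.log L + 1 := by
      have h21 : Real.log (2 * X) ≤ L * Real.exp 1 := by
        have := Real.add_one_le_exp (1 : ℝ); nlinarith
      calc Real.log (Real.log (2 * X)) ≤ Real.log (L * Real.exp 1) := Real.log_le_log (by linarith) h21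
        _ = Real.log L + 1 := by rw [Real.log_mul hL0.ne' (Real.exp_pos 1).ne', Real.log_exp]
    have h3 : Real.log 16 = 4 * Real.log 2 := by
      rw [show (16:ℝ) = 2 ^ 4 by norm_num, Real.log_pow]; norm_num
    have hlog2d : Real.log 2 < 0.6931471808 := Real.log_two_lt_d9
    have hlogL0 := Real.log_nonneg hL1
    linarith
  -- geometry of the window
  have hTHX : t + 2 * TH ≤ X := by
    have : TH ≤ L := by
      rw [hTHdef]
      have : L ^ (1 / 16 : ℝ) ≤ L := by
        calc L ^ (1 / 16 : ℝ) ≤ L ^ (1 : ℝ) := Real.rpow_le_rpow_of_exponent_le hL1 (by norm_num)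
          _ = L := Real.rpow_one L
      linarith
    have hLX : L ≤ X / 4 := by
      -- `log X ≤ X/4`: from `e^{L} ≥ 1 + L + L²/2` and `L ≥ 400`
      have hexpL : Real.exp L = X := by rw [hLdef, Real.exp_log hX0]
      have hq := Real.quadratic_le_exp_of_nonneg hL0.le
      rw [hexpL] at hq
      nlinarith [hL400]
    linarith
  have hfar' : 2 * TH + 2 ≤ |t - t₁| := by
    rw [hTHdef]; linarith
  -- Lemma 5 and the triangle inequality
  rw [blockCofactorPoly_memCoef_eq I f _ _ _ H v t]
  have hxH : -((v : ℝ) / H) = -x := by rw [hxdef]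
  simp only [hxH]
  refine (norm_sum_le _ _).trans ?_
  have hterm : ∀ 𝒥 ∈ (Icc 1 I.J).powerset,
      ‖((-1 : ℝ) ^ #𝒥) • ∑ m ∈ Icc ⌈X * Real.exp (-x)⌉₊ ⌊2 * (X * Real.exp (-x))⌋₊,
          ((I.g 𝒥 m : ℂ) * f m) * (m : ℂ) ^ (-(1 + (t : ℂ) * Complex.I)) /
            ((primeDivisorsIn (Real.exp (L ^ (97 / 100 : ℝ))) (Real.exp (L ^ (99 / 100 : ℝ))) m : ℂ) + 1)‖ ≤
        3 * (C * (1 + K_M)) * L ^ (1 / 50 - 1 / 16 : ℝ) := by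
    intro 𝒥 _
    rw [norm_smul, norm_pow, norm_neg, norm_one, one_pow, one_mul]
    obtain ⟨hmult, hbd⟩ := pmul_g_props_mult I hf hfb 𝒥
    set fJ := f.pmul (toComplexAF (I.g 𝒥)) with hfJ
    -- the floor on the fibres of `X'`
    have hfloor : ∀ Y : ℝ, Ystar X' ≤ Y → ∀ y : ℝ, |y| ≤ 2 * TH →
        M₀ ≤ Msum (siftedTwistC fJ (primesPQ (Real.exp (L ^ (97 / 100 : ℝ))) (Real.exp (L ^ (99 / 100 : ℝ)))) t) Y y := by
      intro Y hY y hy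
      have h := floor_le_Msum hfb I 𝒥 (S := primesPQ (Real.exp (L ^ (97 / 100 : ℝ))) (Real.exp (L ^ (99 / 100 : ℝ))))
        primesPQ_prime (θ := 27 / 40) (B₀ := (13 / 40) * Real.log L - 10) hKh hmin ht₁ ht0 hTHX hfar' hYlowexp hYlow4
        hYlowX hlog16 hB₀ Y hY y hy
      rw [hM₀def, hc]
      exact h
    have h := hL3 fJ hmult hbd X' _ _ t TH M₀ K_M hP2 hPQ hQX' hX'big hTH1 hTH4 hKM0 hKMineq hfloor
    rw [Real.log_exp, Real.log_exp] at h
    have hsum : ∑ n ∈ Icc ⌈X'⌉₊ ⌊2 * X'⌋₊, fJ n * (n : ℂ) ^ (-(1 + (t : ℂ) * Complex.I)) /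
        ((primeDivisorsIn (Real.exp (L ^ (97 / 100 : ℝ))) (Real.exp (L ^ (99 / 100 : ℝ))) n : ℂ) + 1) =
        ∑ m ∈ Icc ⌈X * Real.exp (-x)⌉₊ ⌊2 * (X * Real.exp (-x))⌋₊,
          ((I.g 𝒥 m : ℂ) * f m) * (m : ℂ) ^ (-(1 + (t : ℂ) * Complex.I)) /
            ((primeDivisorsIn (Real.exp (L ^ (97 / 100 : ℝ))) (Real.exp (L ^ (99 / 100 : ℝ))) m : ℂ) + 1) := by
      refine sum_congr rfl fun m _ => ?_
      rw [hfJ, ArithmeticFunction.pmul_apply, toComplexAF_apply, mul_comm (f m)]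
    rw [hsum] at h
    refine h.trans ?_
    have hB := Sieve.MatomakiRadziwillU.lemma3_rhs_le hL1 c2 c3 c5 hy1 hy2
    calc C * (1 + K_M) * (L ^ (99 / 100 : ℝ) / (Real.log X' ^ (1 / 16 : ℝ) * L ^ (97 / 100 : ℝ)) +
          Real.log X' * Real.exp (-(Real.log X' / (3 * L ^ (99 / 100 : ℝ))) * Real.log (Real.log X' / L ^ (99 / 100 : ℝ))))
        ≤ C * (1 + K_M) * (3 * L ^ (1 / 50 - 1 / 16 : ℝ)) := mul_le_mul_of_nonneg_left hB (by positivity)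
      _ = 3 * (C * (1 + K_M)) * L ^ (1 / 50 - 1 / 16 : ℝ) := by ring
  refine (sum_le_sum hterm).trans ?_
  rw [sum_const, nsmul_eq_mul, card_powerset, Nat.card_Icc, Nat.add_sub_cancel]
  push_cast
  rfl

/-- **The range `𝒯₂` for MULTIPLICATIVE `f` (pieces of length `≥ 1`)**: from any Vinogradov–Korobov region
`HasVKZeroFreeRegion cVK TVK` (`cVK > 0`), for every `η ∈ (0, 1/6)` there are `C ≥ 0`, `Xη` such that for `X > Xη`,
`√X ≤ X₀ ≤ X`, every multiplicative `f : ArithmeticFunction ℂ` with `|f| ≤ 1`, every minimiser `t₁` of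
`u ↦ 𝔻(f, n^{iu}; X)²` on `|u| ≤ X` and every `[T₀, T] ⊆ [0, X/2]` with `T ≥ 1` on which `|t − t₁| ≥ (log X)^{1/16}`,
`∫_{T₀}^{T} |F(1+it)|² dt ≤ C (T/(X/Q₁) + 1) ((log Q₁)^{1/3}/P₁^{1/6-η} + (log X)^{-1/50})`, `F = restrDirichlet f I X`.
This is `T2half_of_vk` for multiplicative instead of completely multiplicative `f` (and `T ≥ 1` instead of pieces of any
length): Matomäki–Radziwiłł's Proposition 1 for the coefficients `a = f 1_𝒮`, `b_j = f 1_{𝒮_j}`, `c = f`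
(`Sieve.prop1_coef_of_lemma11`, whose factorisation hypotheses only concern `p ∤ m`, where multiplicativity suffices)
with Lemma 11 from the region (`Sieve.MatomakiRadziwill2016_lemma11_of_vk`) and the Halász input
`exists_cofactor_bound_mult_of_vk`.  (Printed: "Let `f` be a `1`-bounded multiplicative function … In the region
`|t - t₁| ≥ (log X)^{1/16}` … in exactly the same way as [MR]".)
[cite: MatomakiRadziwillTao2015, Appendix A, Proposition A.3 (proof)] [cite: MatomakiRadziwillAnnals2016, Proposition 1] -/
theorem T2one_mult_of_vk {cVK TVK : ℝ} (hcVK : 0 < cVK) (hVK : HasVKZeroFreeRegion cVK TVK) :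
    ∀ η : ℝ, 0 < η → η < 1 / 6 → ∃ C Xη : ℝ, 0 ≤ C ∧ ∀ (X X₀ T₀ T t₁ : ℝ) (I : SieveIntervalSystem η X₀)
      (f : ArithmeticFunction ℂ), f.IsMultiplicative → (∀ n, ‖f n‖ ≤ 1) →
      Xη < X → Real.sqrt X ≤ X₀ → X₀ ≤ X → |t₁| ≤ X →
      pretentiousDistSq f (fun n : ℕ => (n : ℂ) ^ ((t₁ : ℂ) * Complex.I)) X = minPretentiousDistSq f X X →
      0 ≤ T₀ → T₀ ≤ T → 1 ≤ T → T ≤ X / 2 →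
      (∀ t ∈ Set.Icc T₀ T, Real.log X ^ (1 / 16 : ℝ) ≤ |t - t₁|) →
      ∫ t in T₀..T, ‖restrDirichlet f I X t‖ ^ 2 ≤
        C * (T / (X / I.Q 1) + 1) *
          (Real.log (I.Q 1) ^ (1 / 3 : ℝ) / (I.P 1) ^ (1 / 6 - η) + 1 / Real.log X ^ (1 / 50 : ℝ)) := by
  intro η hη hη6
  have hη8 : η ≤ 8 := by linarith
  obtain ⟨C₃, hC₃0, hRev⟩ := exists_cofactor_bound_mult_of_vk hcVK hVK
  obtain ⟨C₁, L₀, hC₁0, hP1⟩ := Sieve.prop1_coef_of_lemma11 (Sieve.MatomakiRadziwill2016_lemma11_of_vk hcVK hVK) hη hη6 C₃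
  obtain ⟨X₁, hX₁⟩ := Filter.eventually_atTop.1 (hRev.and
    ((Real.tendsto_log_atTop.eventually_ge_atTop L₀).and (eventually_ge_atTop (Real.exp 4))))
  refine ⟨C₁, X₁, hC₁0, ?_⟩
  intro X X₀ T₀ T t₁ I f hf hfb hXη hX₀ hX₀X ht₁ heq hT₀ hT₀T hT1 hTX hfar
  obtain ⟨hR, hL₀, hXe4⟩ := hX₁ X hXη.le
  have hX0 : 0 < X := (Real.exp_pos 4).trans_le hXe4
  have hX1 : 1 ≤ X := by have := Real.add_one_le_exp (4:ℝ); linarith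
  have hsX : 0 < Real.sqrt X := Real.sqrt_pos.2 hX0
  have hX₀0 : 0 < X₀ := hsX.trans_le hX₀
  have hlogX : 0 < Real.log X := Real.log_pos (by have := Real.add_one_le_exp (4:ℝ); linarith)
  -- common quantities
  set E₁ : ℝ := Real.log (I.Q 1) ^ (1 / 3 : ℝ) / I.P 1 ^ (1 / 6 - η) with hE₁
  set E₃ : ℝ := 1 / Real.log X ^ (1 / 50 : ℝ) with hE₃
  set R : ℝ := T / (X / I.Q 1) + 1 with hRdef
  have hQ1 : 1 ≤ I.Q 1 := I.one_le_Q hη hη8 le_rfl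
  have hP0 : 0 < I.P 1 := I.pos_P 1 le_rfl
  have hE₁0 : 0 ≤ E₁ := by
    have : 0 ≤ Real.log (I.Q 1) := Real.log_nonneg hQ1
    positivity
  have hE₃0 : 0 ≤ E₃ := by positivity
  have hT0 : 0 ≤ T := hT₀.trans hT₀T
  have hR1 : 1 ≤ R := by
    have : 0 ≤ T / (X / I.Q 1) := by positivity
    linarith
  have hR0 : 0 ≤ R := by linarith
  -- the minimiser property in the form of `exists_cofactor_bound`
  have hmin : ∀ u : ℝ, |u| ≤ X → pretentiousDistSq f (fun n : ℕ => (n : ℂ) ^ ((t₁ : ℂ) * Complex.I)) X ≤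
      pretentiousDistSq f (fun n : ℕ => (n : ℂ) ^ ((u : ℂ) * Complex.I)) X := by
    intro u hu; rw [heq]; exact Halasz.minPretentiousDistSq_le_of_abs_le hfb X hu
  -- Proposition 1 for the coefficients `a = f 1_𝒮`, `b_j = f 1_{𝒮_j}`, `c = f`
  set a : ℕ → ℂ := fun n => if I.Mem n then f n else 0 with ha
  set b : ℕ → ℕ → ℂ := fun j m => if I.MemExcept j m then f m else 0 with hb
  have ha1 : ∀ n, ‖a n‖ ≤ 1 := fun n => by
    simp only [ha]; split_ifs
    · exact hfb n
    · simp
  have hb1 : ∀ j m, ‖b j m‖ ≤ 1 := fun j m => by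
    simp only [hb]; split_ifs
    · exact hfb m
    · simp
  have hsupp : ∀ n, a n ≠ 0 → I.Mem n := fun n hn => by
    by_contra h; simp only [ha, if_neg h] at hn; exact hn rfl
  have hfac : ∀ j ∈ Icc 1 I.J, ∀ m p : ℕ, p.Prime → I.P j ≤ p → (p : ℝ) ≤ I.Q j → ¬ p ∣ m →
      a (m * p) = b j m * f p := by
    intro j hj m p hp hPp hpQ hpm
    have hm : m ≠ 0 := by rintro rfl; exact hpm (dvd_zero p)
    simp only [ha, hb]
    rw [hf.map_mul_of_coprime ((Nat.coprime_comm).1 ((Nat.Prime.coprime_iff_not_dvd hp).2 hpm))]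
    by_cases h : I.MemExcept j m
    · rw [if_pos ((I.mem_mul_prime_iff hη hη8 hj hm hp hPp hpQ).2 h), if_pos h]
    · rw [if_neg (fun h' => h ((I.mem_mul_prime_iff hη hη8 hj hm hp hPp hpQ).1 h')), if_neg h, zero_mul]
  have hQJP : I.Q I.J < Real.exp (Real.log X ^ (97 / 100 : ℝ)) := by
    have h1 : I.Q I.J ≤ Real.exp (Real.sqrt (Real.log X)) :=
      I.Q_J_le.trans (Real.exp_le_exp.2 (Real.sqrt_le_sqrt (Real.log_le_log hX₀0 hX₀X)))
    refine h1.trans_lt (Real.exp_lt_exp.2 ?_)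
    rw [Real.sqrt_eq_rpow]
    have hlogX1 : 1 < Real.log X := by
      rw [← Real.log_exp 1]; exact Real.log_lt_log (Real.exp_pos 1) (lt_of_lt_of_le (Real.exp_lt_exp.2 (by norm_num)) hXe4)
    exact Real.rpow_lt_rpow_of_exponent_lt hlogX1 (by norm_num)
  have hfacU : ∀ m p : ℕ, p.Prime → Real.exp (Real.log X ^ (97 / 100 : ℝ)) ≤ p →
      (p : ℝ) ≤ Real.exp (Real.log X ^ (99 / 100 : ℝ)) → ¬ p ∣ m → a (m * p) = a m * f p := by
    intro m p hp hPp _ hpm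
    have hm : m ≠ 0 := by rintro rfl; exact hpm (dvd_zero p)
    have hiff := I.mem_mul_prime_iff_of_gt hη hη8 hm hp (hQJP.trans_le hPp)
    simp only [ha]
    rw [hf.map_mul_of_coprime ((Nat.coprime_comm).1 ((Nat.Prime.coprime_iff_not_dvd hp).2 hpm))]
    by_cases h : I.Mem m
    · rw [if_pos (hiff.2 h), if_pos h]
    · rw [if_neg (fun h' => h (hiff.1 h')), if_neg h, zero_mul]
  -- `X₀`-conditions
  have hX₀e2 : Real.exp 2 ≤ X₀ := by
    refine le_trans ?_ hX₀
    have : Real.exp 2 = Real.sqrt (Real.exp 4) := by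
      rw [show (4:ℝ) = 2 + 2 by norm_num, Real.exp_add, Real.sqrt_mul_self (Real.exp_pos 2).le]
    rw [this]; exact Real.sqrt_le_sqrt hXe4
  have hLX₀ : Real.log X ≤ 2 * Real.log X₀ := by
    have h1 : X ≤ X₀ ^ 2 := by
      calc X = Real.sqrt X ^ 2 := (Real.sq_sqrt hX0.le).symm
        _ ≤ X₀ ^ 2 := pow_le_pow_left₀ hsX.le hX₀ 2
    calc Real.log X ≤ Real.log (X₀ ^ 2) := Real.log_le_log hX0 h1
      _ = 2 * Real.log X₀ := by rw [Real.log_pow]; ring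
  -- the Halász input
  have hRin : ∀ v ∈ Icc ⌊Real.log X ^ (1 / 50 : ℝ) * Real.log (Real.exp (Real.log X ^ (97 / 100 : ℝ)))⌋₊
        ⌊Real.log X ^ (1 / 50 : ℝ) * Real.log (Real.exp (Real.log X ^ (99 / 100 : ℝ)))⌋₊,
      ∀ t ∈ Set.Icc T₀ T,
        ‖blockCofactorPoly a X (Real.exp (Real.log X ^ (97 / 100 : ℝ))) (Real.exp (Real.log X ^ (99 / 100 : ℝ)))
            (Real.log X ^ (1 / 50 : ℝ)) v t‖ ≤ 2 ^ I.J * (3 * C₃ * Real.log X ^ (1 / 50 - 1 / 16 : ℝ)) := by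
    intro v hv t ht
    exact hR η X₀ I f hf hfb t₁ ht₁ hmin t (hT₀.trans ht.1) (ht.2.trans hTX) (hfar t ht) v hv
  have hmain := hP1 X X₀ I a f b T₀ T hL₀ hX₀e2 hX₀X hLX₀ ha1 hb1 hfb hsupp hfac hfacU hT₀ hT₀T hT1
    (by linarith) hRin
  -- the integrand
  have hsum : ∀ t : ℝ, ∑ n ∈ Icc ⌈X⌉₊ ⌊2 * X⌋₊, a n * (n : ℂ) ^ (-(1 + (t : ℂ) * Complex.I)) =
      restrDirichlet f I X t := by
    intro t
    unfold restrDirichlet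
    rw [sum_filter]
    refine sum_congr rfl fun n _ => ?_
    simp only [ha]
    split_ifs <;> simp
  simp_rw [hsum] at hmain
  simpa only [hE₁, hE₃] using hmain

end MRT2015

end Literature.NumberTheory.LFunctions
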